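import Summits.BirchSwinnertonDyer.BirchSwinnertonDyer.Theorems.SchneiderFreeAdditiveX3UpperGordCellOfPartnerLowerHeegner
import HarnessLib

/-!
# Route `SchneiderFreeAdditiveX3Upper` (K1 wing): the wing LEAF and `BSD(E,p)` on the whole cell with wing r2 WEAKENED to
# «twist-unit datum ∨ (G-ord pair whose class has a Case-1 road for its Heegner twists)» — the exact target a restated r2 would close

Cell `bsd-schneider-ideate`, seat `bsd-schneider-door-c5` (prover, generation 21; assembly layer; `--supports` 20364).
PARTITION: board row B6 ∩ X3 ∩ sst-twist, `r = 1` (7 101 pairs; (M) 4 541 / (G-ord, `e = 2`) 2 560) of `Rank1Residual.partition`;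
types-the-object-of nothing new; closes none of B6's cells (BSD NOT advanced).  bears_on: K1-wing (20364 r2, 20366 r4, 20365 r3, leaf
`Upper.AdditiveX3RankOneUpper`) + K1-door (19177 r3, 19176 r2) + K1 (19363, CLOSED).

Continuation of `…UpperGordCellOfPartnerLower[Heegner]` (the (G-ord) upper half per pair from the Heegner twist's LOWER half).  Here the two
per-pair roads are put side by side and re-assembled to the class level:
* §1 `missingUpperBoundAt_gordTwo_of_twistUnit_or_case1_…` — the (G-ord) upper half per pair from «`Upper.TwistUnitFieldOffSliverAt W p`
  (the certificate) ∨ every rank-0 minimal Heegner twist of `W` has a Case-1 member (the K1 road)»;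
  `missingUpperBoundAt_potMult_of_twistUnitAt_…` — the (M) upper half per pair from the pair's twist-unit datum and wing r4.
* §2 `additiveX3RankOneUpper_of_printedFacts_of_potMultCo_of_twistUnitOrCase1_…` — the wing LEAF `Upper.AdditiveX3RankOneUpper` ⇐
  door `PrintedFacts` ∧ `PotMultBranchCoIMC` (wing r4) ∧ Hsieh 2014 Thm A ∧ LZZ 2018 ∧ Keller–Yin clause (iii) (PREPRINT) ∧ CH-signed ∧
  `hPL` (K1 item 19363's conclusion shape) ∧ **the WEAKENED r2** `∀ (W, p) on the cell, TwistUnitFieldOffSliverAt W p ∨ (SubGordTwo W p ∧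
  Case-1 members for the rank-0 Heegner twists)`; `missingPPartAt_sstTwist_…` / `bsdp_sstTwist_…` with the door's inputs (r2 (M), KY (μ)).
On the census (N < 5·10⁵) the weakened r2 holds at 7 100 / 7 101 pairs (TU certificates: census-P2-g13, 7 093; odd multiplicative-type
p-line: kit j311549, 549 (G-ord) classes; union misses only (450450cj1, 3) among (G-ord) pairs and the 7 (M) TU-residual pairs of
conductor 406980 / 450450 remain on the (M) side — see memos/FINDING-door-c5-g21.md §1b).

HONEST FRAMING: THEOREMS ONLY; pure composition of tree theorems; CONDITIONAL on the displayed hypotheses (Keller–Yin preprint; wing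
r4 / door r2 have no printed input; `hPL` is K1's CLOSED item modulo its printed/reading facts; the weakened r2 is still a hypothesis —
a certificate or a structural condition per pair); nothing is closed by me; BSD is proved for no curve; «closes rung: none».
References: [GreenbergVatsal2000] §2 p. 28, Thm. 3.12; [MilneADT2006] Thm. I.7.3; [GrossZagier1986] I.(6.3), (7.3);
[JetchevSkinnerWan2017] §7.4.1; [Miller2011LMS] Def. 1.1; [KellerYin2024b] Thm. 3.5.1 (preprint); [KrizLi2019] Thm. 1.20.
-/

set_option autoImplicit false
-- `Summit.<P>.<Sub>` repeats `BirchSwinnertonDyer` by the tree's layout convention (D-0017)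
set_option linter.dupNamespace false

noncomputable section

open scoped Classical NumberField

open Field NumberField IsDedekindDomain WeierstrassCurve
  Literature.NumberTheory.EllipticCurves Literature.NumberTheory.EllipticCurves.GreenbergSelmer
  Literature.NumberTheory.GaloisRepresentations Literature.NumberTheory.GaloisCohomology
  Literature.NumberTheory.EllipticCurves.ModularForms Literature.NumberTheory.EllipticCurves.Rank1Residual
  Literature.NumberTheory.EllipticCurves.Rank1Residual.Typed
  Literature.NumberTheory.EllipticCurves.KellerYin2024
  Summit.BirchSwinnertonDyer.Rank1Residual Summit.BirchSwinnertonDyer.Rank1Residual.Additive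
  Summit.BirchSwinnertonDyer.Rank1Residual.X11b
  Summit.BirchSwinnertonDyer.BirchSwinnertonDyer.Theorems.SchneiderFree
  Summit.BirchSwinnertonDyer.BirchSwinnertonDyer.Theorems.SchneiderFree.Upper
  Summit.BirchSwinnertonDyer.BirchSwinnertonDyer.Theses.SchneiderFreeAdditiveX3
  Summit.BirchSwinnertonDyer.BirchSwinnertonDyer.Theorems.SchneiderFreeAdditiveX3.ControlDischarged

-- the wing route's crux decls, by name (its `PrintedFacts` is the door's, same body)
open Summit.BirchSwinnertonDyer.BirchSwinnertonDyer.Theses.SchneiderFreeAdditiveX3Upper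
  (GordTwoBranchCoIMCField PotMultBranchCoIMC TwistUnitX3OffSliver)

namespace Summit.BirchSwinnertonDyer.BirchSwinnertonDyer.Theorems.SchneiderFreeAdditiveX3.KYBranchOnly

/-! ### §1 The upper half per pair: (G-ord) from «TU ∨ Case-1 road», (M) from TU and wing r4 -/

/-- **UPPER half per pair on the (G-ord, `e = 2`) cell from «the twist-unit datum ∨ the Case-1 road»** — `…GordCellOfKYBranchOnly`'s
`missingUpperBoundAt_gordTwo_of_printedFacts_of_twistUnitAt_…` on the first disjunct, `…UpperGordCellOfPartnerLower`'s
`missingUpperBoundAt_gordTwo_of_partnerLowerHeegner_…` on the second (Case-1 members asked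
only for the rank-0 twists by IMAGINARY quadratic Heegner fields — the satisfiable form).  CONDITIONAL; closes no item; BSD not advanced.
[cite: JetchevSkinnerWan2017, §7.4.1 (arXiv:1512.06894 p. 30)] [cite: GreenbergVatsal2000, §2 p. 28] -/
theorem missingUpperBoundAt_gordTwo_of_twistUnit_or_case1_of_hsieh_of_lzz_of_KY_branch_of_castellaHsieh_signed (hF : PrintedFacts)
    (hA : Hsieh2014.thmA_exists_isHsiehLFunction_unrPeriod_anyLevel)
    (hL : LiuZhangZhang2018.thm151_thm153_modularCurve_heegnerVector_additive)
    (hKYb : thm351_charIdeal_eq_branch_OPEN) (hCHσ : castellaHsieh2018_exists_isBranchBDPLFunction_signed)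
    (hPL : ∀ (Wd : WeierstrassCurve ℚ) [Wd.IsElliptic] [Wd.IsGloballyMinimal] (p : ℕ) [Fact p.Prime],
      Wd.analyticRank = 0 → N10.CellGordTwo Wd p → HasCaseOneMember Wd p → MissingLowerBoundAt Wd p) :
    ∀ (W : WeierstrassCurve ℚ) [W.IsElliptic] [W.IsGloballyMinimal] (p : ℕ) [Fact p.Prime],
      W.analyticRank = 1 → p ≠ 2 → ClassX3 W p → Additive.SubGordTwo W p →
      (Upper.TwistUnitFieldOffSliverAt W p ∨
        ∀ (K : Type) [Field K] [NumberField K], IsImaginaryQuadratic K → SatisfiesHeegnerHypothesis (W.conductorNorm ℤ) K →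
          ∀ (Wd : WeierstrassCurve ℚ) [Wd.IsElliptic] [Wd.IsGloballyMinimal],
            (∃ C : VariableChange ℚ, C • W.quadraticTwist (NumberField.discr K : ℚ) = Wd) → Wd.analyticRank = 0 →
            HasCaseOneMember Wd p) →
      MissingUpperBoundAt W p := by
  intro W _ _ p _ hr hp2 hX hG h
  rcases h with hTU | hC1
  · exact missingUpperBoundAt_gordTwo_of_printedFacts_of_twistUnitAt_of_hsieh_of_lzz_of_KY_branch_of_castellaHsieh_signed hF hA hL
      hKYb hCHσ W p hr hp2 hX hG hTU
  · exact missingUpperBoundAt_gordTwo_of_partnerLowerHeegner_of_hsieh_of_lzz_of_KY_branch_of_castellaHsieh_signed hF hA hL hKYb hCHσ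
      hPL W p hr hp2 hX hG hC1

/-- **UPPER half per pair on the (M) cell from the pair's twist-unit datum and wing r4** (`PotMultBranchCoIMC`): door-c5 gen 10's glue
`Upper.missingUpperBoundAt_of_goodMemberCoStepLField_of_twistUnitFieldOffSliver` with the (M) co-chain member
(`Upper.coChainMemberField_potMult_of_coIMC_of_control`, CLOSED control corner).  CONDITIONAL (wing r4 has no printed input);
closes no item; BSD not advanced. [cite: JetchevSkinnerWan2017, §7.4.1 (arXiv:1512.06894 p. 30)] [cite: Miller2011LMS, Def. 1.1] -/
theorem missingUpperBoundAt_potMult_of_printedFacts_of_potMultCo_of_twistUnitAt (hF : PrintedFacts) (hCoM : PotMultBranchCoIMC) :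
    ∀ (W : WeierstrassCurve ℚ) [W.IsElliptic] [W.IsGloballyMinimal] (p : ℕ) [Fact p.Prime],
      W.analyticRank = 1 → p ≠ 2 → ClassX3 W p → Additive.SubM W p → Upper.TwistUnitFieldOffSliverAt W p →
      MissingUpperBoundAt W p := by
  obtain ⟨hGZ, hKo, hGZK, hmod, hPar, hCas, hGZ73, -, -, hHP, -, -, -⟩ := hF
  have hCtl := anticycControlAdditiveKF_proof controlFacts_proof.1 controlFacts_proof.2.1 controlFacts_proof.2.2.1
    controlFacts_proof.2.2.2 hKo
  intro W _ _ p _ hr hp2 hX hM hTU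
  have hpN : p ∣ W.conductorNorm ℤ := (W.dvd_conductorNorm_iff_not_hasGoodReductionAtPrime p).mpr hX.2.1
  exact Upper.missingUpperBoundAt_of_goodMemberCoStepLField_of_twistUnitFieldOffSliver hGZ hKo hGZK hmod hGZ73 hCas hHP W p hr hp2
    hpN (fun K _ _ hK _ hpd _ ↦ Upper.coChainMemberField_potMult_of_coIMC_of_control hKo hPar hCtl hCoM W p hr hp2 hX hM K hK hpd) hTU

/-! ### §2 The wing LEAF and both halves on the whole cell with the WEAKENED r2 -/

/-- **The wing's rung leaf `SchneiderFree.Upper.AdditiveX3RankOneUpper` with wing r2 WEAKENED** ⇐ door `PrintedFacts` ∧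
`PotMultBranchCoIMC` (wing r4) ∧ Hsieh 2014 Thm A ∧ Liu–Zhang–Zhang 2018 ∧ Keller–Yin clause (iii) (PREPRINT) ∧ Castella–Hsieh
signed existence ∧ `hPL` (rung K1's item 19363 conclusion shape: rank-0 (G-ord, `e = 2`) curves with a Case-1 member have the lower
half) ∧ the weakened r2 «at every pair of the cell: the twist-unit datum, OR the pair is (G-ord, `e = 2`) and every rank-0 minimal
Heegner twist has a Case-1 member».  With `hPL` := `AdditiveBranchIMCInputs.x3CaseOneRankZero_of_facts` this rests on published
facts, K1's readings, one preprint clause, wing r4 and the weakened r2 only.  CONDITIONAL; closes no item by name; BSD NOT advanced.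
[cite: KellerYin2024b, Thm. 3.5.1 (arXiv:2410.23241 p. 20) (preprint; hypotheses)] [cite: GreenbergVatsal2000, §2 p. 28 and Thm. 3.12]
[cite: JetchevSkinnerWan2017, §7.4.1 (arXiv:1512.06894 p. 30)] -/
theorem additiveX3RankOneUpper_of_printedFacts_of_potMultCo_of_twistUnitOrCase1_of_hsieh_of_lzz_of_KY_branch_of_castellaHsieh_signed
    (hF : PrintedFacts) (hCoM : PotMultBranchCoIMC) (hA : Hsieh2014.thmA_exists_isHsiehLFunction_unrPeriod_anyLevel)
    (hL : LiuZhangZhang2018.thm151_thm153_modularCurve_heegnerVector_additive)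
    (hKYb : thm351_charIdeal_eq_branch_OPEN) (hCHσ : castellaHsieh2018_exists_isBranchBDPLFunction_signed)
    (hPL : ∀ (Wd : WeierstrassCurve ℚ) [Wd.IsElliptic] [Wd.IsGloballyMinimal] (p : ℕ) [Fact p.Prime],
      Wd.analyticRank = 0 → N10.CellGordTwo Wd p → HasCaseOneMember Wd p → MissingLowerBoundAt Wd p)
    (hR2 : ∀ (W : WeierstrassCurve ℚ) [W.IsElliptic] [W.IsGloballyMinimal] (p : ℕ) [Fact p.Prime],
      W.analyticRank = 1 → p ≠ 2 → ClassX3 W p → Additive.SubSemistableTwist W p →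
      Upper.TwistUnitFieldOffSliverAt W p ∨ (Additive.SubGordTwo W p ∧
        ∀ (K : Type) [Field K] [NumberField K], IsImaginaryQuadratic K → SatisfiesHeegnerHypothesis (W.conductorNorm ℤ) K →
          ∀ (Wd : WeierstrassCurve ℚ) [Wd.IsElliptic] [Wd.IsGloballyMinimal],
            (∃ C : VariableChange ℚ, C • W.quadraticTwist (NumberField.discr K : ℚ) = Wd) → Wd.analyticRank = 0 →
            HasCaseOneMember Wd p)) :
    Upper.AdditiveX3RankOneUpper := by
  intro W _ _ p _ hr hp2 hX hS
  rcases hR2 W p hr hp2 hX hS with hTU | ⟨hG, hC1⟩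
  · rcases hS with hM | hG
    · exact missingUpperBoundAt_potMult_of_printedFacts_of_potMultCo_of_twistUnitAt hF hCoM W p hr hp2 hX hM hTU
    · exact missingUpperBoundAt_gordTwo_of_printedFacts_of_twistUnitAt_of_hsieh_of_lzz_of_KY_branch_of_castellaHsieh_signed hF hA hL
        hKYb hCHσ W p hr hp2 hX hG hTU
  · exact missingUpperBoundAt_gordTwo_of_partnerLowerHeegner_of_hsieh_of_lzz_of_KY_branch_of_castellaHsieh_signed hF hA hL hKYb hCHσ
      hPL W p hr hp2 hX hG hC1

/-- **`MissingPPartAt` on the whole cell with the WEAKENED r2**: the door's LEAF (`…GordCellOfKYBranchOnly` §1: PrintedFacts ∧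
door r2 `PotMultBranchIMC` ∧ Hsieh ∧ LZZ ∧ KY (iii)+(μ) ∧ CHσ) and §2's wing leaf, through `missingPPartAt_of_lower_of_upper`.
CONDITIONAL; closes nothing; BSD not advanced beyond this typed reduction. [cite: Miller2011LMS, Def. 1.1]
[cite: KellerYin2024b, Thm. 3.5.1 (arXiv:2410.23241 p. 20) (preprint; hypotheses)] -/
theorem missingPPartAt_sstTwist_of_printedFacts_of_potMultCruxes_of_twistUnitOrCase1_of_hsieh_of_lzz_of_KY_branch_of_castellaHsieh_signed
    (hF : PrintedFacts) (h2 : PotMultBranchIMC) (hCoM : PotMultBranchCoIMC)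
    (hA : Hsieh2014.thmA_exists_isHsiehLFunction_unrPeriod_anyLevel)
    (hL : LiuZhangZhang2018.thm151_thm153_modularCurve_heegnerVector_additive)
    (hKYb : thm351_charIdeal_eq_branch_OPEN) (hKYμ : thm351_mu_zero_branch_OPEN)
    (hCHσ : castellaHsieh2018_exists_isBranchBDPLFunction_signed)
    (hPL : ∀ (Wd : WeierstrassCurve ℚ) [Wd.IsElliptic] [Wd.IsGloballyMinimal] (p : ℕ) [Fact p.Prime],
      Wd.analyticRank = 0 → N10.CellGordTwo Wd p → HasCaseOneMember Wd p → MissingLowerBoundAt Wd p)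
    (hR2 : ∀ (W : WeierstrassCurve ℚ) [W.IsElliptic] [W.IsGloballyMinimal] (p : ℕ) [Fact p.Prime],
      W.analyticRank = 1 → p ≠ 2 → ClassX3 W p → Additive.SubSemistableTwist W p →
      Upper.TwistUnitFieldOffSliverAt W p ∨ (Additive.SubGordTwo W p ∧
        ∀ (K : Type) [Field K] [NumberField K], IsImaginaryQuadratic K → SatisfiesHeegnerHypothesis (W.conductorNorm ℤ) K →
          ∀ (Wd : WeierstrassCurve ℚ) [Wd.IsElliptic] [Wd.IsGloballyMinimal],
            (∃ C : VariableChange ℚ, C • W.quadraticTwist (NumberField.discr K : ℚ) = Wd) → Wd.analyticRank = 0 →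
            HasCaseOneMember Wd p)) :
    ∀ (W : WeierstrassCurve ℚ) [W.IsElliptic] [W.IsGloballyMinimal] (p : ℕ) [Fact p.Prime],
      W.analyticRank = 1 → p ≠ 2 → ClassX3 W p → Additive.SubSemistableTwist W p → MissingPPartAt W p :=
  fun W _ _ p _ hr hp2 hX hS =>
    missingPPartAt_of_lower_of_upper W p
      (additiveX3RankOneLower_of_printedFacts_of_potMult_of_hsieh_of_lzz_of_KY_branch_of_castellaHsieh_signed hF h2 hA hL hKYb
        hKYμ hCHσ W p hr hp2 hX hS)
      (additiveX3RankOneUpper_of_printedFacts_of_potMultCo_of_twistUnitOrCase1_of_hsieh_of_lzz_of_KY_branch_of_castellaHsieh_signed hF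
        hCoM hA hL hKYb hCHσ hPL hR2 W p hr hp2 hX hS)

/-- **Miller's `BSD(E, p)` on the whole cell with the WEAKENED r2** (`bsdp_of_missingPPartAt`; GZK).  NOT a proof of BSD for any
curve: the K1 rung's complete residual with wing r2 replaced by «certificate ∨ Case-1 road». [cite: Miller2011LMS, §1 and Def. 1.1] -/
theorem bsdp_sstTwist_of_printedFacts_of_potMultCruxes_of_twistUnitOrCase1_of_hsieh_of_lzz_of_KY_branch_of_castellaHsieh_signed
    (hF : PrintedFacts) (h2 : PotMultBranchIMC) (hCoM : PotMultBranchCoIMC)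
    (hA : Hsieh2014.thmA_exists_isHsiehLFunction_unrPeriod_anyLevel)
    (hL : LiuZhangZhang2018.thm151_thm153_modularCurve_heegnerVector_additive)
    (hKYb : thm351_charIdeal_eq_branch_OPEN) (hKYμ : thm351_mu_zero_branch_OPEN)
    (hCHσ : castellaHsieh2018_exists_isBranchBDPLFunction_signed)
    (hPL : ∀ (Wd : WeierstrassCurve ℚ) [Wd.IsElliptic] [Wd.IsGloballyMinimal] (p : ℕ) [Fact p.Prime],
      Wd.analyticRank = 0 → N10.CellGordTwo Wd p → HasCaseOneMember Wd p → MissingLowerBoundAt Wd p)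
    (hR2 : ∀ (W : WeierstrassCurve ℚ) [W.IsElliptic] [W.IsGloballyMinimal] (p : ℕ) [Fact p.Prime],
      W.analyticRank = 1 → p ≠ 2 → ClassX3 W p → Additive.SubSemistableTwist W p →
      Upper.TwistUnitFieldOffSliverAt W p ∨ (Additive.SubGordTwo W p ∧
        ∀ (K : Type) [Field K] [NumberField K], IsImaginaryQuadratic K → SatisfiesHeegnerHypothesis (W.conductorNorm ℤ) K →
          ∀ (Wd : WeierstrassCurve ℚ) [Wd.IsElliptic] [Wd.IsGloballyMinimal],
            (∃ C : VariableChange ℚ, C • W.quadraticTwist (NumberField.discr K : ℚ) = Wd) → Wd.analyticRank = 0 →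
            HasCaseOneMember Wd p)) :
    ∀ (W : WeierstrassCurve ℚ) [W.IsElliptic] [W.IsGloballyMinimal] (p : ℕ) [Fact p.Prime],
      W.analyticRank = 1 → p ≠ 2 → ClassX3 W p → Additive.SubSemistableTwist W p → BSDp W p :=
  fun W _ _ p _ hr hp2 hX hS =>
    bsdp_of_missingPPartAt W p hF.2.2.1 (le_of_eq hr)
      (missingPPartAt_sstTwist_of_printedFacts_of_potMultCruxes_of_twistUnitOrCase1_of_hsieh_of_lzz_of_KY_branch_of_castellaHsieh_signed
        hF h2 hCoM hA hL hKYb hKYμ hCHσ hPL hR2 W p hr hp2 hX hS)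

end Summit.BirchSwinnertonDyer.BirchSwinnertonDyer.Theorems.SchneiderFreeAdditiveX3.KYBranchOnly

end
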